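import Literature.Geometry.Symplectic.SelfDualTripleFrame
import Literature.Geometry.Symplectic.OrigamiUnfoldingProofs
import Mathlib.Analysis.InnerProductSpace.Calculus
import HarnessLib

/-!
# Smooth dependence of the quaternionic frame of a wedge-orthonormal triple

Topic `Geometry/Symplectic`; namespace `Literature.Geometry.Symplectic`.  Theorems only; no named
fact, no `sorry`.  The frame `f = (x, I₁x, I₂x, I₃x)` and the coefficient `c(x) = η₁(x, I₁x)` of
`SelfDualTripleFrame.lean` are explicit rational expressions in the components of the triple
`(η₁, η₂, η₃)` (Pfaffian adjugates divided by Pfaffians).  Hence, along `C^∞` families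
`η_k(θ)` with non-vanishing Pfaffians, the frame vectors and the coefficient are `C^∞` in `θ`
(`contDiff_frame_comp`, `contDiff_frameCoeff_comp`).  Building blocks: `contDiff_pfaffAdjCol_comp`,
`contDiff_pairMap_comp`, `contDiff_pairComplex_comp`, `contDiff_alt_two_comp₂` (a smooth family of
forms evaluated on smooth families of vectors).  This is the smoothness-in-parameters of the
pointwise construction of Perutz 2006, Lemma 2.1 (b), needed along a zero circle (§3).

## References

* T. Perutz, *Zero-sets of near-symplectic forms*, J. Symplectic Geom. 4 (2006), Lemma 2.1 (b)
  and §3. [Perutz2006]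
-/

noncomputable section

open Set Function Module Literature.Geometry.Kaehler Literature.Topology.FourManifolds
open scoped ContDiff

namespace Literature.Geometry.Symplectic

variable {X : Type*} [NormedAddCommGroup X] [NormedSpace ℝ X]

/-! ### Vectors of `ℝ⁴` with smooth components; smooth evaluation -/

/-- A map into `ℝ⁴` with `C^∞` components `![f₀, f₁, f₂, f₃]` is `C^∞`. [folklore] -/
theorem contDiff_toLp_four {f₀ f₁ f₂ f₃ : X → ℝ} (h₀ : ContDiff ℝ ∞ f₀) (h₁ : ContDiff ℝ ∞ f₁)
    (h₂ : ContDiff ℝ ∞ f₂) (h₃ : ContDiff ℝ ∞ f₃) :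
    ContDiff ℝ ∞ fun x ↦ (WithLp.toLp 2 ![f₀ x, f₁ x, f₂ x, f₃ x] : EuclideanSpace ℝ (Fin 4)) := by
  rw [contDiff_euclidean]
  intro i
  fin_cases i
  · simpa using h₀
  · simpa using h₁
  · simpa using h₂
  · simpa using h₃

/-- The coordinates of a smooth map into `ℝ⁴` are smooth. [folklore] -/
theorem contDiff_coord {u : X → EuclideanSpace ℝ (Fin 4)} (hu : ContDiff ℝ ∞ u) (k : Fin 4) :
    ContDiff ℝ ∞ fun x ↦ u x k :=
  contDiff_euclidean.1 hu k

/-- A smooth family of `2`-forms evaluated on fixed vectors is smooth. [folklore] -/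
theorem contDiff_alt_two_comp {f : X → (EuclideanSpace ℝ (Fin 4)) [⋀^Fin 2]→L[ℝ] ℝ}
    (hf : ContDiff ℝ ∞ f) (m : Fin 2 → EuclideanSpace ℝ (Fin 4)) :
    ContDiff ℝ ∞ fun x ↦ f x m :=
  (contDiff_alt_two_eval m).comp hf

/-- Double expansion `η(u, v) = Σ_k (Σ_l −η(e_k, e_l) u_l) v_k`. [folklore] -/
theorem alt_two_sum_sum_coord (β : (EuclideanSpace ℝ (Fin 4)) [⋀^Fin 2]→L[ℝ] ℝ)
    (u v : EuclideanSpace ℝ (Fin 4)) :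
    β ![u, v] = ∑ k, (∑ l, -(β ![stdVec k, stdVec l] * u l)) * v k := by
  rw [alt_two_sum_right]
  refine Finset.sum_congr rfl fun k _ ↦ ?_
  congr 1
  rw [alt_two_swap β (stdVec k) u, alt_two_sum_right, ← Finset.sum_neg_distrib]

/-- **A smooth family of `2`-forms evaluated on smooth families of vectors is smooth.**
[folklore] -/
theorem contDiff_alt_two_comp₂ {f : X → (EuclideanSpace ℝ (Fin 4)) [⋀^Fin 2]→L[ℝ] ℝ}
    {u v : X → EuclideanSpace ℝ (Fin 4)} (hf : ContDiff ℝ ∞ f) (hu : ContDiff ℝ ∞ u)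
    (hv : ContDiff ℝ ∞ v) : ContDiff ℝ ∞ fun x ↦ f x ![u x, v x] := by
  have h : (fun x ↦ f x ![u x, v x]) =
      fun x ↦ ∑ k, (∑ l, -(f x ![stdVec k, stdVec l] * u x l)) * v x k := by
    funext x; exact alt_two_sum_sum_coord (f x) (u x) (v x)
  rw [h]
  refine ContDiff.sum fun k _ ↦ (ContDiff.sum fun l _ ↦ ?_).mul (contDiff_coord hv k)
  exact ((contDiff_alt_two_comp hf _).mul (contDiff_coord hu l)).neg

/-! ### The Pfaffian adjugate, the pair map and the pair complex structure -/

/-- **The Pfaffian adjugate columns of a smooth family are smooth** (their entries are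
`±` components of the form). [folklore] -/
theorem contDiff_pfaffAdjCol_comp {f : X → (EuclideanSpace ℝ (Fin 4)) [⋀^Fin 2]→L[ℝ] ℝ}
    (hf : ContDiff ℝ ∞ f) (k : Fin 4) : ContDiff ℝ ∞ fun x ↦ pfaffAdjCol (f x) k := by
  have e := fun m ↦ contDiff_alt_two_comp hf m
  fin_cases k
  · simp only [pfaffAdjCol, Fin.zero_eta, Fin.isValue, Matrix.cons_val_zero]
    exact contDiff_toLp_four contDiff_const (e _) (e _).neg (e _)
  · simp only [pfaffAdjCol, Fin.mk_one, Fin.isValue, Matrix.cons_val_one, Matrix.cons_val_zero]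
    exact contDiff_toLp_four (e _).neg contDiff_const (e _) (e _).neg
  · simp only [pfaffAdjCol, Fin.reduceFinMk, Fin.isValue, Matrix.cons_val]
    exact contDiff_toLp_four (e _) (e _).neg contDiff_const (e _)
  · simp only [pfaffAdjCol, Fin.reduceFinMk, Fin.isValue, Matrix.cons_val]
    exact contDiff_toLp_four (e _).neg (e _) (e _).neg contDiff_const

/-- **The pair map of smooth families is smooth**: `pairMap α β v = Σ_k β(v, e_k) adj_k(α)`.
[folklore] -/
theorem contDiff_pairMap_comp {f g : X → (EuclideanSpace ℝ (Fin 4)) [⋀^Fin 2]→L[ℝ] ℝ}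
    (hf : ContDiff ℝ ∞ f) (hg : ContDiff ℝ ∞ g) (v : EuclideanSpace ℝ (Fin 4)) :
    ContDiff ℝ ∞ fun x ↦ pairMap (f x) (g x) v := by
  unfold pairMap
  exact ContDiff.sum fun k _ ↦ (contDiff_alt_two_comp hg _).smul (contDiff_pfaffAdjCol_comp hf k)

/-- **The pair complex structure of smooth families is smooth** where `Pf(α) ≠ 0`:
`pairComplex α β v = −Pf(α)⁻¹ pairMap α β v`. [cite: Perutz2006, Lemma 2.1 (b)] -/
theorem contDiff_pairComplex_comp {f g : X → (EuclideanSpace ℝ (Fin 4)) [⋀^Fin 2]→L[ℝ] ℝ}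
    (hf : ContDiff ℝ ∞ f) (hg : ContDiff ℝ ∞ g) (hP : ∀ x, pfaffian (f x) ≠ 0)
    (v : EuclideanSpace ℝ (Fin 4)) : ContDiff ℝ ∞ fun x ↦ pairComplex (f x) (g x) v := by
  unfold pairComplex
  exact ((contDiff_pfaffian.comp hf).inv hP).neg.smul (contDiff_pairMap_comp hf hg v)

/-! ### The frame and its coefficient -/

/-- **The quaternionic frame of a smooth family of triples is smooth**: for `C^∞` families
`η₁, η₂, η₃` with non-vanishing Pfaffians, each frame vector
`frame η₁ η₂ η₃ x = (x, I₁x, I₂x, I₃x)` is `C^∞` in the parameter. [cite: Perutz2006, Lemma 2.1 (b)] -/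
theorem contDiff_frame_comp {η₁ η₂ η₃ : X → (EuclideanSpace ℝ (Fin 4)) [⋀^Fin 2]→L[ℝ] ℝ}
    (h₁ : ContDiff ℝ ∞ η₁) (h₂ : ContDiff ℝ ∞ η₂) (h₃ : ContDiff ℝ ∞ η₃)
    (hP₁ : ∀ x, pfaffian (η₁ x) ≠ 0) (hP₂ : ∀ x, pfaffian (η₂ x) ≠ 0)
    (hP₃ : ∀ x, pfaffian (η₃ x) ≠ 0) (v : EuclideanSpace ℝ (Fin 4)) (i : Fin 4) :
    ContDiff ℝ ∞ fun x ↦ IsWedgeOrthonormalTriple.frame (η₁ x) (η₂ x) (η₃ x) v i := by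
  fin_cases i
  · change ContDiff ℝ ∞ fun x ↦ v
    exact contDiff_const
  · change ContDiff ℝ ∞ fun x ↦ pairComplex (η₃ x) (η₂ x) v
    exact contDiff_pairComplex_comp h₃ h₂ hP₃ v
  · change ContDiff ℝ ∞ fun x ↦ pairComplex (η₁ x) (η₃ x) v
    exact contDiff_pairComplex_comp h₁ h₃ hP₁ v
  · change ContDiff ℝ ∞ fun x ↦ pairComplex (η₂ x) (η₁ x) v
    exact contDiff_pairComplex_comp h₂ h₁ hP₂ v

/-- **The frame coefficient `c(x) = η₁(x, I₁x)` of a smooth family of triples is smooth.**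
[cite: Perutz2006, Lemma 2.1 (b)] -/
theorem contDiff_frameCoeff_comp {η₁ η₂ η₃ : X → (EuclideanSpace ℝ (Fin 4)) [⋀^Fin 2]→L[ℝ] ℝ}
    (h₁ : ContDiff ℝ ∞ η₁) (h₂ : ContDiff ℝ ∞ η₂) (h₃ : ContDiff ℝ ∞ η₃)
    (hP₃ : ∀ x, pfaffian (η₃ x) ≠ 0) (v : EuclideanSpace ℝ (Fin 4)) :
    ContDiff ℝ ∞ fun x ↦ IsWedgeOrthonormalTriple.frameCoeff (η₁ x) (η₂ x) (η₃ x) v := by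
  change ContDiff ℝ ∞ fun x ↦ η₁ x ![v, pairComplex (η₃ x) (η₂ x) v]
  exact contDiff_alt_two_comp₂ h₁ contDiff_const (contDiff_pairComplex_comp h₃ h₂ hP₃ v)

/-- **The frame map `u ↦ Σ uᵢ fᵢ` applied to a smooth family of vectors is smooth** (jointly in
the triple and the coefficients). [cite: Perutz2006, Lemma 2.1 (b)] -/
theorem contDiff_sum_smul_frame_comp
    {η₁ η₂ η₃ : X → (EuclideanSpace ℝ (Fin 4)) [⋀^Fin 2]→L[ℝ] ℝ}
    (h₁ : ContDiff ℝ ∞ η₁) (h₂ : ContDiff ℝ ∞ η₂) (h₃ : ContDiff ℝ ∞ η₃)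
    (hP₁ : ∀ x, pfaffian (η₁ x) ≠ 0) (hP₂ : ∀ x, pfaffian (η₂ x) ≠ 0)
    (hP₃ : ∀ x, pfaffian (η₃ x) ≠ 0) (v : EuclideanSpace ℝ (Fin 4)) {a : X → Fin 4 → ℝ}
    (ha : ∀ i, ContDiff ℝ ∞ fun x ↦ a x i) :
    ContDiff ℝ ∞ fun x ↦ ∑ i, a x i • IsWedgeOrthonormalTriple.frame (η₁ x) (η₂ x) (η₃ x) v i :=
  ContDiff.sum fun i _ ↦ (ha i).smul (contDiff_frame_comp h₁ h₂ h₃ hP₁ hP₂ hP₃ v i)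

end Literature.Geometry.Symplectic

end
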